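import Literature.MeasureTheory.Hausdorff.ConeVolume
import Mathlib.MeasureTheory.Measure.Lebesgue.VolumeOfBalls
import Mathlib.MeasureTheory.Integral.Bochner.ContinuousLinearMap
import HarnessLib

/-!
# Radial integrals over off-centre balls of `ℝ³` (the shell formula)

Support file (all results proved, nothing cited as a fact) for the discharge of
`Yuhjtman2015_minDistance` (`Yuhjtman2015Proofs.lean`): S. A. Yuhjtman, *A sensible estimate for
the stability constant of the Lennard-Jones potential*, J. Stat. Phys. 160 (2015), Formulas 1
(p. 3: volume of the intersection of two balls, area of a sphere inside another ball), in the form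
actually used there (proofs of Prop. 5 II and Prop. 8: "we can treat the integral of `θ` with
spherical coordinates, taking advantage of the absence of angular dependence"):

* `volume_ball_inter_closedBall` — the **lens volume**: for `z ∈ ℝ³`, `r = ‖z‖ > c > 0` and
  `r - c ≤ w ≤ r + c`, `vol (B(z,c) ∩ B̄(0,w)) = (π/r) ∫_{r-c}^{w} v (c² - (v-r)²) dv`
  (Cavalieri: in coordinates adapted to an orthonormal basis with third vector `z/‖z‖`, the
  slices perpendicular to `z` are discs; `Literature.MeasureTheory.Hausdorff.coneCoord`).
* `map_norm_volume_restrict_ball` — hence the push-forward of Lebesgue measure on `B(z,c)` under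
  `y ↦ ‖y‖` is `(π/r) v (c² - (v-r)²) dv` on `(r-c, r+c]` (`Measure.ext_of_Iic`), and
* `setIntegral_ball_fun_norm` — the **shell formula**
  `∫_{B(z,c)} f(‖y‖) dy = ∫_{r-c}^{r+c} (π/r) v (c² - (v-r)²) f(v) dv` for every measurable
  `f : ℝ → ℝ` (Yuhjtman's Formula 1 b) integrated over the radius: the sphere `‖y‖ = v` meets
  `B(z,c)` in a cap of area `(π v/r)(c² - (v-r)²)`).

Mathlib has polar coordinates about the centre of symmetry (`integral_fun_norm_addHaar`) but no
formula for balls not centred at the origin; the present file supplies the three-dimensional case.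
-/

noncomputable section

open Set Metric Module Filter
open _root_.MeasureTheory _root_.MeasureTheory.Measure
open scoped ENNReal NNReal Topology RealInnerProductSpace

namespace Literature.MathematicalPhysics.StatisticalMechanics

open Literature.MeasureTheory.Hausdorff

/-! ### The lens in adapted coordinates -/

/-- The closed planar disc `{w : Fin 2 → ℝ | w 0 ² + w 1 ² ≤ R ²}` has Lebesgue measure `π R²`.
[folklore] -/
theorem volume_closedDisc_fin_two {R : ℝ} (hR : 0 ≤ R) :
    volume {w : Fin 2 → ℝ | w 0 ^ 2 + w 1 ^ 2 ≤ R ^ 2} = ENNReal.ofReal (Real.pi * R ^ 2) := by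
  have hmp := PiLp.volume_preserving_toLp (Fin 2)
  have hset : {w : Fin 2 → ℝ | w 0 ^ 2 + w 1 ^ 2 ≤ R ^ 2} =
      (WithLp.toLp 2) ⁻¹' closedBall (0 : EuclideanSpace ℝ (Fin 2)) R := by
    ext w
    simp [EuclideanSpace.closedBall_zero_eq R hR, Fin.sum_univ_two]
  rw [hset, hmp.measure_preimage measurableSet_closedBall.nullMeasurableSet,
    EuclideanSpace.volume_closedBall_fin_two, ← ENNReal.ofReal_pow hR,
    ← ENNReal.ofReal_mul (by positivity), mul_comm]

/-- The planar set `{q < ρ₁} ∩ {q ≤ ρ₂}`, `q = w 0 ² + w 1 ²`, has measure `π · min ρ₁ ρ₂`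
(`ENNReal.ofReal`, so `0` when the minimum is negative). [folklore] -/
theorem volume_disc_inter_closedDisc (ρ₁ ρ₂ : ℝ) :
    volume {w : Fin 2 → ℝ | w 0 ^ 2 + w 1 ^ 2 < ρ₁ ∧ w 0 ^ 2 + w 1 ^ 2 ≤ ρ₂} =
      ENNReal.ofReal (Real.pi * min ρ₁ ρ₂) := by
  rcases le_or_gt ρ₁ ρ₂ with h12 | h21
  · -- the open disc is the smaller one
    rw [min_eq_left h12]
    have hset : {w : Fin 2 → ℝ | w 0 ^ 2 + w 1 ^ 2 < ρ₁ ∧ w 0 ^ 2 + w 1 ^ 2 ≤ ρ₂} =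
        {w : Fin 2 → ℝ | w 0 ^ 2 + w 1 ^ 2 < ρ₁} := by
      ext w
      simp only [mem_setOf_eq, and_iff_left_iff_imp]
      intro h
      exact (h.le.trans h12)
    rw [hset]
    rcases le_or_gt ρ₁ 0 with h0 | h0
    · have hemp : {w : Fin 2 → ℝ | w 0 ^ 2 + w 1 ^ 2 < ρ₁} = ∅ := by
        ext w
        simp only [mem_setOf_eq, mem_empty_iff_false, iff_false, not_lt]
        exact h0.trans (by positivity)
      rw [hemp, measure_empty, ENNReal.ofReal_of_nonpos (mul_nonpos_of_nonneg_of_nonpos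
        Real.pi_pos.le h0)]
    · have hsq : Real.sqrt ρ₁ ^ 2 = ρ₁ := Real.sq_sqrt h0.le
      have := volume_disc_fin_two (Real.sqrt_nonneg ρ₁)
      rw [hsq] at this
      exact this
  · rw [min_eq_right h21.le]
    have hset : {w : Fin 2 → ℝ | w 0 ^ 2 + w 1 ^ 2 < ρ₁ ∧ w 0 ^ 2 + w 1 ^ 2 ≤ ρ₂} =
        {w : Fin 2 → ℝ | w 0 ^ 2 + w 1 ^ 2 ≤ ρ₂} := by
      ext w
      simp only [mem_setOf_eq, and_iff_right_iff_imp]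
      intro h
      exact h.trans_lt h21
    rw [hset]
    rcases lt_or_ge ρ₂ 0 with h0 | h0
    · have hemp : {w : Fin 2 → ℝ | w 0 ^ 2 + w 1 ^ 2 ≤ ρ₂} = ∅ := by
        ext w
        simp only [mem_setOf_eq, mem_empty_iff_false, iff_false, not_le]
        exact h0.trans_le (by positivity)
      rw [hemp, measure_empty, ENNReal.ofReal_of_nonpos (mul_nonpos_of_nonneg_of_nonpos
        Real.pi_pos.le h0.le)]
    · have hsq : Real.sqrt ρ₂ ^ 2 = ρ₂ := Real.sq_sqrt h0
      have := volume_closedDisc_fin_two (Real.sqrt_nonneg ρ₂)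
      rw [hsq] at this
      exact this

/-- The lens `B((r,0,0), c) ∩ B̄(0, w)` in the coordinates `(t, w₀, w₁)` of `ℝ × ℝ²`. [folklore] -/
def lensProd (r c w : ℝ) : Set (ℝ × (Fin 2 → ℝ)) :=
  {p | (p.1 - r) ^ 2 + (p.2 0 ^ 2 + p.2 1 ^ 2) < c ^ 2 ∧ p.1 ^ 2 + (p.2 0 ^ 2 + p.2 1 ^ 2) ≤ w ^ 2}

/-- The lens is measurable. [folklore] -/
theorem measurableSet_lensProd (r c w : ℝ) : MeasurableSet (lensProd r c w) := by
  have h1 : Measurable fun p : ℝ × (Fin 2 → ℝ) ↦ (p.1 - r) ^ 2 + (p.2 0 ^ 2 + p.2 1 ^ 2) := by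
    fun_prop
  have h2 : Measurable fun p : ℝ × (Fin 2 → ℝ) ↦ p.1 ^ 2 + (p.2 0 ^ 2 + p.2 1 ^ 2) := by
    fun_prop
  exact (measurableSet_lt h1 measurable_const).inter (measurableSet_le h2 measurable_const)

/-- The slice profile of the lens: at height `t` the slice is a disc of squared radius
`min (c² - (t-r)²) (w² - t²)` (when nonnegative). [folklore] -/
def lensSlice (r c w t : ℝ) : ℝ := min (c ^ 2 - (t - r) ^ 2) (w ^ 2 - t ^ 2)

/-- The slices of the lens are discs of area `π · lensSlice`. [folklore] -/
theorem volume_slice_lensProd (r c w t : ℝ) :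
    volume (Prod.mk t ⁻¹' lensProd r c w) = ENNReal.ofReal (Real.pi * lensSlice r c w t) := by
  have hset : Prod.mk t ⁻¹' lensProd r c w =
      {q : Fin 2 → ℝ | q 0 ^ 2 + q 1 ^ 2 < c ^ 2 - (t - r) ^ 2 ∧ q 0 ^ 2 + q 1 ^ 2 ≤ w ^ 2 - t ^ 2} := by
    ext q
    simp only [lensProd, mem_preimage, mem_setOf_eq]
    constructor
    · rintro ⟨h1, h2⟩; exact ⟨by linarith, by linarith⟩
    · rintro ⟨h1, h2⟩; exact ⟨by linarith, by linarith⟩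
  rw [hset, volume_disc_inter_closedDisc]
  rfl

/-- The antiderivative `∫ v (c² - (v - r)²) dv` used for the lens volume. [folklore] -/
def lensPrim (r c v : ℝ) : ℝ :=
  -((v - r) ^ 4 / 4) - r * (v - r) ^ 3 / 3 + c ^ 2 * (v - r) ^ 2 / 2 + r * c ^ 2 * v

/-- `lensPrim` is an antiderivative of `v (c² - (v - r)²)`. [folklore] -/
theorem hasDerivAt_lensPrim (r c v : ℝ) :
    HasDerivAt (lensPrim r c) (v * (c ^ 2 - (v - r) ^ 2)) v := by
  have h1 : HasDerivAt (fun v : ℝ ↦ v - r) 1 v := (hasDerivAt_id' v).sub_const r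
  have h := ((((h1.fun_pow 4).div_const 4).fun_neg).fun_sub
    (((h1.fun_pow 3).const_mul r).div_const 3)).fun_add
    (((h1.fun_pow 2).const_mul (c ^ 2)).div_const 2) |>.fun_add
    ((hasDerivAt_id' v).const_mul (r * c ^ 2))
  refine h.congr_deriv ?_
  norm_num
  ring

/-- The one-variable integral behind the lens volume: with `t* = (w² + r² - c²)/(2r)`,
`∫_{r-c}^{w} min (c² - (t-r)², w² - t²) dt = (1/r) ∫_{r-c}^{w} v (c² - (v-r)²) dv`
(`0 < c < r`, `r - c ≤ w ≤ r + c`). [folklore] -/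
theorem integral_lensSlice {r c w : ℝ} (hc : 0 < c) (hcr : c < r) (hw1 : r - c ≤ w)
    (hw2 : w ≤ r + c) :
    ∫ t in (r - c)..w, lensSlice r c w t = (lensPrim r c w - lensPrim r c (r - c)) / r := by
  have hr : 0 < r := hc.trans hcr
  set ts : ℝ := (w ^ 2 + r ^ 2 - c ^ 2) / (2 * r) with hts
  have hts1 : r - c ≤ ts := by
    rw [hts, le_div_iff₀ (by positivity)]
    nlinarith
  have hts2 : ts ≤ w := by
    rw [hts, div_le_iff₀ (by positivity)]
    nlinarith
  -- split the integral at `ts`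
  have hcont : Continuous (lensSlice r c w) := by
    unfold lensSlice
    fun_prop
  rw [← intervalIntegral.integral_add_adjacent_intervals (b := ts)
    (hcont.intervalIntegrable _ _) (hcont.intervalIntegrable _ _)]
  -- on `[r - c, ts]` the first disc is the smaller one
  have hleft : ∫ t in (r - c)..ts, lensSlice r c w t = ∫ t in (r - c)..ts, (c ^ 2 - (t - r) ^ 2) := by
    refine intervalIntegral.integral_congr fun t ht ↦ ?_
    rw [uIcc_of_le hts1] at ht
    unfold lensSlice
    refine min_eq_left ?_
    have : t ≤ ts := ht.2
    rw [hts, le_div_iff₀ (by positivity)] at this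
    nlinarith
  have hright : ∫ t in ts..w, lensSlice r c w t = ∫ t in ts..w, (w ^ 2 - t ^ 2) := by
    refine intervalIntegral.integral_congr fun t ht ↦ ?_
    rw [uIcc_of_le hts2] at ht
    unfold lensSlice
    refine min_eq_right ?_
    have : ts ≤ t := ht.1
    rw [hts, div_le_iff₀ (by positivity)] at this
    nlinarith
  have hI1 : ∫ t in (r - c)..ts, (c ^ 2 - (t - r) ^ 2) =
      (c ^ 2 * ts - (ts - r) ^ 3 / 3) - (c ^ 2 * (r - c) - ((r - c) - r) ^ 3 / 3) := by
    refine intervalIntegral.integral_eq_sub_of_hasDerivAt (f := fun t ↦ c ^ 2 * t - (t - r) ^ 3 / 3)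
      (fun t _ ↦ ?_) ((by fun_prop : Continuous fun t : ℝ ↦ c ^ 2 - (t - r) ^ 2).intervalIntegrable
        _ _)
    have h1 : HasDerivAt (fun t : ℝ ↦ t - r) 1 t := (hasDerivAt_id' t).sub_const r
    have h := ((hasDerivAt_id' t).const_mul (c ^ 2)).fun_sub ((h1.fun_pow 3).div_const 3)
    refine h.congr_deriv ?_
    norm_num
  have hI2 : ∫ t in ts..w, (w ^ 2 - t ^ 2) =
      (w ^ 2 * w - w ^ 3 / 3) - (w ^ 2 * ts - ts ^ 3 / 3) := by
    refine intervalIntegral.integral_eq_sub_of_hasDerivAt (f := fun t ↦ w ^ 2 * t - t ^ 3 / 3)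
      (fun t _ ↦ ?_) ((by fun_prop : Continuous fun t : ℝ ↦ w ^ 2 - t ^ 2).intervalIntegrable _ _)
    have h := ((hasDerivAt_id' t).const_mul (w ^ 2)).fun_sub
      (((hasDerivAt_id' t).fun_pow 3).div_const 3)
    refine h.congr_deriv ?_
    norm_num
  rw [hleft, hright, hI1, hI2, hts]
  unfold lensPrim
  field_simp
  ring

/-- `lensSlice` is nonnegative on `[r - c, w]` (`0 < c < r`, `w ≤ r + c`). [folklore] -/
theorem lensSlice_nonneg {r c w t : ℝ} (hcr : c < r) (hw2 : w ≤ r + c) (ht1 : r - c ≤ t)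
    (ht2 : t ≤ w) : 0 ≤ lensSlice r c w t := by
  unfold lensSlice
  refine le_min ?_ ?_
  · have h1 : -c ≤ t - r := by linarith
    have h2 : t - r ≤ c := by linarith
    nlinarith
  · have h1 : 0 ≤ t := by linarith
    nlinarith

/-- `lensSlice` is nonpositive off `[r - c, w]` (`0 < c < r`, `r - c ≤ w`). [folklore] -/
theorem lensSlice_nonpos {r c w t : ℝ} (hc : 0 < c) (hcr : c < r) (hw1 : r - c ≤ w)
    (ht : t ∉ Icc (r - c) w) : lensSlice r c w t ≤ 0 := by
  unfold lensSlice
  rw [mem_Icc, not_and_or, not_le, not_le] at ht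
  rcases ht with ht | ht
  · refine (min_le_left _ _).trans ?_
    have h1 : c < r - t := by linarith
    nlinarith
  · refine (min_le_right _ _).trans ?_
    have h1 : 0 < w := by linarith
    nlinarith

/-- **Volume of the lens in adapted coordinates** (Cavalieri over the disc slices):
`vol (lensProd r c w) = (π/r) ∫_{r-c}^{w} v (c² - (v-r)²) dv`. [folklore] -/
theorem volume_lensProd {r c w : ℝ} (hc : 0 < c) (hcr : c < r) (hw1 : r - c ≤ w)
    (hw2 : w ≤ r + c) :
    volume (lensProd r c w) =
      ENNReal.ofReal (Real.pi * ((lensPrim r c w - lensPrim r c (r - c)) / r)) := by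
  have hS := measurableSet_lensProd r c w
  rw [show (volume : Measure (ℝ × (Fin 2 → ℝ))) = volume.prod volume from rfl,
    Measure.prod_apply hS]
  simp_rw [volume_slice_lensProd]
  have hind : (fun t ↦ ENNReal.ofReal (Real.pi * lensSlice r c w t)) =
      (Icc (r - c) w).indicator (fun t ↦ ENNReal.ofReal (Real.pi * lensSlice r c w t)) := by
    funext t
    by_cases ht : t ∈ Icc (r - c) w
    · rw [indicator_of_mem ht]
    · rw [indicator_of_notMem ht, ENNReal.ofReal_of_nonpos (mul_nonpos_of_nonneg_of_nonpos
        Real.pi_pos.le (lensSlice_nonpos hc hcr hw1 ht))]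
  rw [hind, lintegral_indicator measurableSet_Icc]
  have hcont : Continuous fun t ↦ Real.pi * lensSlice r c w t := by
    unfold lensSlice
    fun_prop
  have hint : IntegrableOn (fun t ↦ Real.pi * lensSlice r c w t) (Icc (r - c) w) volume :=
    hcont.integrableOn_Icc
  have hnn : 0 ≤ᵐ[volume.restrict (Icc (r - c) w)] fun t ↦ Real.pi * lensSlice r c w t := by
    rw [EventuallyLE, ae_restrict_iff' measurableSet_Icc]
    exact Eventually.of_forall fun t ht ↦
      mul_nonneg Real.pi_pos.le (lensSlice_nonneg hcr hw2 ht.1 ht.2)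
  rw [← ofReal_integral_eq_lintegral_ofReal hint hnn]
  congr 1
  rw [integral_Icc_eq_integral_Ioc, ← intervalIntegral.integral_of_le hw1,
    intervalIntegral.integral_const_mul, integral_lensSlice hc hcr hw1 hw2]

/-! ### The lens volume in `ℝ³` -/

section Space

variable {E : Type*} [NormedAddCommGroup E] [InnerProductSpace ℝ E]

/-- In a `3`-dimensional inner product space every unit vector is the third vector of an
orthonormal basis. [folklore] -/
theorem exists_orthonormalBasis_apply_two_eq [FiniteDimensional ℝ E] (hE : finrank ℝ E = 3)
    {u : E} (hu : ‖u‖ = 1) : ∃ b : OrthonormalBasis (Fin 3) ℝ E, b 2 = u := by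
  have h : Orthonormal ℝ (({2} : Set (Fin 3)).restrict fun _ : Fin 3 ↦ u) := by
    refine ⟨fun i ↦ by simpa using hu, ?_⟩
    intro i j hij
    exact absurd (Subsingleton.elim i j) hij
  obtain ⟨b, hb⟩ := h.exists_orthonormalBasis_extension_of_card_eq (by simp [hE])
  exact ⟨b, hb 2 (by simp)⟩

/-- The lens `B(r b₂, c) ∩ B̄(0, w)` (`c, w ≥ 0`) in the coordinates adapted to `b`. [folklore] -/
theorem ball_inter_closedBall_eq_preimage (b : OrthonormalBasis (Fin 3) ℝ E) {r c w : ℝ}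
    (hc : 0 ≤ c) (hw : 0 ≤ w) :
    ball (r • b 2) c ∩ closedBall (0 : E) w = coneCoord b ⁻¹' lensProd r c w := by
  ext y
  simp only [mem_inter_iff, mem_ball, mem_closedBall, dist_eq_norm, sub_zero, mem_preimage,
    lensProd, mem_setOf_eq, coneCoord_fst, coneCoord_snd_zero, coneCoord_snd_one]
  have hb2 : ‖b 2‖ = 1 := b.orthonormal.1 2
  have hsq : ‖y - r • b 2‖ ^ 2 = (⟪b 2, y⟫ - r) ^ 2 + (⟪b 0, y⟫ ^ 2 + ⟪b 1, y⟫ ^ 2) := by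
    rw [norm_sub_sq_real, inner_smul_right, real_inner_comm, norm_smul, Real.norm_eq_abs, hb2,
      mul_one, sq_abs, norm_sq_eq_sum_three b y]
    ring
  have hsq' : ‖y‖ ^ 2 = ⟪b 2, y⟫ ^ 2 + (⟪b 0, y⟫ ^ 2 + ⟪b 1, y⟫ ^ 2) := by
    rw [norm_sq_eq_sum_three b y]
    ring
  rw [← hsq, ← hsq', pow_lt_pow_iff_left₀ (norm_nonneg _) hc two_ne_zero,
    pow_le_pow_iff_left₀ (norm_nonneg _) hw two_ne_zero]

variable [FiniteDimensional ℝ E] [MeasurableSpace E] [BorelSpace E]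

/-- **Volume of a lens** (Yuhjtman 2015, Formula 1 a), integrated form): for `‖z‖ = r > c > 0`
and `r - c ≤ w ≤ r + c`, `vol (B(z,c) ∩ B̄(0,w)) = (π/r) ∫_{r-c}^{w} v (c² - (v-r)²) dv`.
[cite: Yuhjtman2015, Formulas 1] -/
theorem volume_ball_inter_closedBall (hE : finrank ℝ E = 3) {z : E} {c w : ℝ} (hc : 0 < c)
    (hcz : c < ‖z‖) (hw1 : ‖z‖ - c ≤ w) (hw2 : w ≤ ‖z‖ + c) :
    volume (ball z c ∩ closedBall (0 : E) w) =
      ENNReal.ofReal (Real.pi * ((lensPrim ‖z‖ c w - lensPrim ‖z‖ c (‖z‖ - c)) / ‖z‖)) := by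
  set r := ‖z‖ with hr_def
  have hr : 0 < r := hc.trans hcz
  have hu : ‖r⁻¹ • z‖ = 1 := by
    rw [norm_smul, norm_inv, Real.norm_eq_abs, abs_of_pos hr, ← hr_def, inv_mul_cancel₀ hr.ne']
  obtain ⟨b, hb⟩ := exists_orthonormalBasis_apply_two_eq hE hu
  have hz : z = r • b 2 := by rw [hb, smul_smul, mul_inv_cancel₀ hr.ne', one_smul]
  have hw : 0 ≤ w := le_trans (by linarith) hw1
  rw [hz, ball_inter_closedBall_eq_preimage b hc.le hw,
    (measurePreserving_coneCoord b).measure_preimage (measurableSet_lensProd r c w).nullMeasurableSet,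
    volume_lensProd hc hcz hw1 hw2]

/-! ### The push-forward of Lebesgue measure on a ball under the norm -/

/-- The density `(π/r) v (c² - (v - r)²)` of the radius `‖y‖` for `y` uniform in `B(z, c)`,
`‖z‖ = r` (the area of the part of the sphere of radius `v` inside `B(z,c)`; Yuhjtman 2015,
Formula 1 b)). [cite: Yuhjtman2015, Formulas 1] -/
def lensDensity (r c v : ℝ) : ℝ := Real.pi / r * (v * (c ^ 2 - (v - r) ^ 2))

/-- The density is nonnegative for radii that occur. [folklore] -/
theorem lensDensity_nonneg {r c v : ℝ} (hr : 0 < r) (hv : 0 ≤ v) (h1 : r - c ≤ v)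
    (h2 : v ≤ r + c) : 0 ≤ lensDensity r c v := by
  unfold lensDensity
  refine mul_nonneg (div_nonneg Real.pi_pos.le hr.le) (mul_nonneg hv ?_)
  have : -c ≤ v - r := by linarith
  have : v - r ≤ c := by linarith
  nlinarith

/-- The density is continuous. [folklore] -/
theorem continuous_lensDensity (r c : ℝ) : Continuous (lensDensity r c) := by
  unfold lensDensity
  fun_prop

/-- `∫_a^b lensDensity = (π/r) (lensPrim b - lensPrim a)`. [folklore] -/
theorem integral_lensDensity (r c a a' : ℝ) :
    ∫ v in a..a', lensDensity r c v = Real.pi * ((lensPrim r c a' - lensPrim r c a) / r) := by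
  unfold lensDensity
  rw [intervalIntegral.integral_const_mul, intervalIntegral.integral_eq_sub_of_hasDerivAt
    (fun v _ ↦ hasDerivAt_lensPrim r c v)
    ((by fun_prop : Continuous fun v : ℝ ↦ v * (c ^ 2 - (v - r) ^ 2)).intervalIntegrable _ _)]
  ring

/-- **The radius of a uniform point of `B(z,c)`** (`‖z‖ = r > c > 0`): the push-forward of
Lebesgue measure on `B(z,c)` under `y ↦ ‖y‖` is `(π/r) v (c² - (v-r)²) dv` on `(r-c, r+c]`.
[folklore] -/
theorem map_norm_volume_restrict_ball (hE : finrank ℝ E = 3) {z : E} {c : ℝ} (hc : 0 < c)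
    (hcz : c < ‖z‖) :
    Measure.map (fun y : E ↦ ‖y‖) (volume.restrict (ball z c)) =
      (volume.restrict (Ioc (‖z‖ - c) (‖z‖ + c))).withDensity
        (fun v ↦ ENNReal.ofReal (lensDensity ‖z‖ c v)) := by
  set r := ‖z‖ with hr_def
  have hr : 0 < r := hc.trans hcz
  haveI : IsFiniteMeasure (volume.restrict (ball z c)) :=
    isFiniteMeasure_restrict.2 measure_ball_lt_top.ne
  refine Measure.ext_of_Iic _ _ fun a ↦ ?_
  rw [Measure.map_apply measurable_norm measurableSet_Iic,
    Measure.restrict_apply (measurable_norm measurableSet_Iic), withDensity_apply _ measurableSet_Iic,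
    Measure.restrict_restrict measurableSet_Iic]
  have hpre : (fun y : E ↦ ‖y‖) ⁻¹' Iic a = closedBall 0 a := by
    ext y
    simp
  rw [hpre, Set.inter_comm]
  rcases lt_or_ge a (r - c) with ha | ha
  · -- below `r - c` both sides vanish
    have h1 : ball z c ∩ closedBall (0 : E) a = ∅ := by
      ext y
      simp only [mem_inter_iff, mem_ball, mem_closedBall, dist_zero_right, mem_empty_iff_false,
        iff_false, not_and, not_le]
      intro hy
      have := norm_sub_norm_le z y
      rw [← dist_eq_norm, dist_comm] at this
      linarith
    have h2 : Iic a ∩ Ioc (r - c) (r + c) = ∅ := by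
      ext v
      simp only [mem_inter_iff, mem_Iic, mem_Ioc, mem_empty_iff_false, iff_false, not_and, not_le]
      intro hv hv'
      linarith
    rw [h1, h2, measure_empty, Measure.restrict_empty, lintegral_zero_measure]
  · set w := min a (r + c) with hw_def
    have hw1 : r - c ≤ w := le_min ha (by linarith)
    have hw2 : w ≤ r + c := min_le_right _ _
    have h1 : ball z c ∩ closedBall (0 : E) a = ball z c ∩ closedBall 0 w := by
      ext y
      simp only [mem_inter_iff, mem_ball, mem_closedBall, dist_zero_right, hw_def, le_min_iff,
        and_congr_right_iff]
      intro hy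
      constructor
      · intro hya
        refine ⟨hya, ?_⟩
        have := norm_le_norm_add_norm_sub' y z
        rw [← dist_eq_norm] at this
        linarith
      · exact fun h ↦ h.1
    have h2 : Iic a ∩ Ioc (r - c) (r + c) = Ioc (r - c) w := by
      ext v
      simp only [mem_inter_iff, mem_Iic, mem_Ioc, hw_def, le_min_iff]
      tauto
    rw [h1, h2, volume_ball_inter_closedBall hE hc hcz hw1 hw2]
    have hint : IntegrableOn (lensDensity r c) (Ioc (r - c) w) volume :=
      ((continuous_lensDensity r c).integrableOn_Icc).mono_set Ioc_subset_Icc_self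
    have hnn : 0 ≤ᵐ[volume.restrict (Ioc (r - c) w)] lensDensity r c := by
      rw [EventuallyLE, ae_restrict_iff' measurableSet_Ioc]
      exact Eventually.of_forall fun v hv ↦
        lensDensity_nonneg hr (by linarith [hv.1]) hv.1.le (hv.2.trans hw2)
    rw [← ofReal_integral_eq_lintegral_ofReal hint hnn, ← intervalIntegral.integral_of_le hw1,
      integral_lensDensity]

/-- **The shell formula** (Yuhjtman 2015, Formula 1 b) integrated): for `‖z‖ = r > c > 0` and
any measurable `f : ℝ → ℝ`,
`∫_{B(z,c)} f(‖y‖) dy = ∫_{r-c}^{r+c} (π/r) v (c² - (v-r)²) f(v) dv`. [cite: Yuhjtman2015, Formulas 1] -/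
theorem setIntegral_ball_fun_norm (hE : finrank ℝ E = 3) {z : E} {c : ℝ} (hc : 0 < c)
    (hcz : c < ‖z‖) {f : ℝ → ℝ} (hf : Measurable f) :
    ∫ y in ball z c, f ‖y‖ = ∫ v in (‖z‖ - c)..(‖z‖ + c), lensDensity ‖z‖ c v * f v := by
  have hr : 0 < ‖z‖ := hc.trans hcz
  rw [← integral_map (f := f) (φ := fun y : E ↦ ‖y‖) measurable_norm.aemeasurable
    hf.aestronglyMeasurable, map_norm_volume_restrict_ball hE hc hcz,
    integral_withDensity_eq_integral_toReal_smul (continuous_lensDensity ‖z‖ c).measurable.ennreal_ofReal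
    (Eventually.of_forall fun _ ↦ ENNReal.ofReal_lt_top), intervalIntegral.integral_of_le (by linarith)]
  refine setIntegral_congr_fun measurableSet_Ioc fun v hv ↦ ?_
  rw [smul_eq_mul, ENNReal.toReal_ofReal (lensDensity_nonneg hr (by linarith [hv.1]) hv.1.le hv.2)]

end Space

end Literature.MathematicalPhysics.StatisticalMechanics

end
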